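import Literature.NumberTheory.Rogawski1990.RankOneUnstableDeltaValueRamified      -- ★ B-p10 (g26) R-4: the Cayley parameter, `μ_w(z − 1) = μ_w(2η)·(b₀, θ)_v`
import Literature.NumberTheory.QuadraticForms.HilbertSymbolLocal                   -- ★ `isSquare_of_isSquare_residue`, `hilbertSymbol_eq_neg_one_of_not_isSquare_residue_of_odd` (non-dyadic)
import Literature.NumberTheory.QuadraticForms.HilbertSymbolBilinear                -- ★ `hilbertSymbol_adicCompletion_mul_left` (every finite place)
import Literature.NumberTheory.QuadraticForms.HilbertSymbolNonDyadic               -- ★ `hilbertSymbol_self_right` (`(a, a) = (a, −1)`), `hilbertSymbol_mul_sq_right`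
import Literature.NumberTheory.Automorphic.RamifiedPlaceAntiFixedUniformizer       -- ★ F0P3a-p04 p843426: a skew uniformizer `ϖ_E` of `L_w` at a ramified place (`σ_w ϖ_E = −ϖ_E`)
import HarnessLib

/-!
# R-4b: TAME EVALUATION OF THE CAYLEY SIGN — at a tamely ramified place `(π^k β, θ)_v = s₀^k · χ_v(β̄)`, `s₀ = (−1, π)_v`, and `θ_v ∼ π` (square classes)
# (Rogawski 1990 §4.9 p. 55; Labesse–Langlands 1979 §2 (2.1)–(2.2); O'Meara §63B 63:11a ∕ 63:12; Serre, *Local Fields* XIV §3 «the tamely ramified case»)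

Topic `NumberTheory/Rogawski1990`; namespace `Literature.NumberTheory.Rogawski1990`.  THEOREMS ONLY (no definition, no instance, no notation, no named fact, no `sorry`).  Cell
`pub/hodgecm-mathlib` (D-0151), crux H413 = `stmt-HodgeConjecture-24833`, road «R1-ram» (architect A-p16 (g27)); companion of ★ R-4 `RankOneUnstableDeltaValueRamified` (p843425) answering
B-p12 (g29) MEMO (R5b-α) 06d3de01 point (6)∕(6′): ★ R-4 reads the oscillating sign of the rank-one transfer factor at a ramified place as the Hilbert symbol `(b₀(t), θ)_v` of the
CAYLEY PARAMETER; the (R5b-β) assembler (F0P3a-p03 (g12)) needs it EVALUATED so that its `N`-dependence `s₀^{(N−1)∕2}` cancels against the D-side sign law (★ B-p12 FILES 4–5).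
HONEST LABEL: HC_CM is proved only modulo the printed citations (the 2 remaining named inputs hLiu418, h413) until rung 0 closes; nothing printed is asserted here.

THE MATHEMATICS (TAME: `2 ∈ 𝒪_vˣ`).  §1 at any finite place `v` of a number field `K`, `K_v = v.adicCompletion K`, `𝓀_v` its residue field: for `d` of ODD valuation and a unit `β ∈ 𝒪_vˣ`,
`(β, d)_v = 1 ⟺ β̄ ∈ 𝓀_v²` (★ Hensel for squares + ★ O'Meara 63:11a), `(−1, d)_v = 1 ⟺ −1 ∈ 𝓀_v²`, and by bimultiplicativity (★ `hilbertSymbol_adicCompletion_mul_left`) with `(d, d) = (d, −1)`: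
**`(d^k·x, d)_v = (−1, d)_v^k · (x, d)_v`**; every `b ≠ 0` with `|b|_v = |π|_v^k` is `π^k·β` with `β ∈ 𝒪_vˣ` (`exists_eq_pow_mul_coe_unit`).  §2 at a RAMIFIED non-split `w ∣ v` of the CM
field `L` (`he : e(w|v) ≠ 1`, tame `|2|_w = 1`): with `ϖ_E` a SKEW uniformizer of `L_w` (★ p843426) and `α` the CM generator (`α² = θ`, `cα = −α`), both `ϖ_E²` and `α_w∕ϖ_E` are
`σ_w`-fixed, so `ϖ_E² = ι_w(π)` with `π` a UNIFORMIZER of `L⁺_v` (`e = 2`: `|ι_w y|_w = |y|_v²`) and `θ_v = π·g²` (`g = ι_w⁻¹(α_w∕ϖ_E) ≠ 0`) — **`(x, θ_v)_v = (x, π)_v` for every `x`**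
(★ `hilbertSymbol_mul_sq_right`).  Hence for the Cayley parameter `b₀ = π^k β₀` of ★ R-4: `(b₀, θ)_v = s₀^k · (±1 according as β̄₀ ∈ 𝓀_v²)`, `s₀ := (−1, π)_v` — MEMO (6′)'s
`s₀^r χ(β̄₀)`; the residue match `χ(β̄₀(t))·ε₀(t) = const` is the assembler's three lines (B-p12 (6′)).

* §1 `hilbertSymbol_one_left'`, `hilbertSymbol_coe_eq_one_of_isSquare_residue`, **`hilbertSymbol_coe_eq_one_iff_isSquare_residue_of_odd`** (+ `…eq_neg_one_iff_not_isSquare…`),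
  `hilbertSymbol_neg_one_eq_one_iff_of_odd`, **`hilbertSymbol_pow_mul_self_right`** (`(d^k x, d) = (−1,d)^k (x,d)`), `exists_eq_pow_mul_coe_unit` (unit part).
* §2 **`exists_uniformizer_cmQuadraticGenerator_eq_mul_sq`** (`θ_v = π g²`, `|π|_v = exp(−1)`, `ι_w π = ϖ_E²`), **`hilbertSymbol_cmQuadraticGenerator_eq_of_ramified`** (`(x,θ_v)_v = (x,π)_v`).

## References
* [Rogawski1990] J. D. Rogawski, *Automorphic Representations of Unitary Groups in Three Variables* (1990): §4.9 p. 55 (`μ|_{F^×} = ω_{E∕F}`), Lemma 4.9.3 p. 56.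
* [LabesseLanglands1979] J.-P. Labesse, R. P. Langlands, *L-indistinguishability for SL(2)*, Canad. J. Math. 31 (1979): §2 (2.1)–(2.2) (the weight `κ(bϖ^{−m})`, ramified torus).
* [Omeara1963] O. T. O'Meara, *Introduction to Quadratic Forms* (1963): §63B, 63:11a, Example 63:12 (`(π, δ)_𝔭 = 1` iff `δ` is a square, non-dyadic).
* [Serre1979] J.-P. Serre, *Local Fields*, GTM 67 (1979): Ch. XIV §3 (the symbol `(a, b)_v` in the tamely ramified case).
-/

set_option autoImplicit false

noncomputable section

open NumberField IsDedekindDomain Valued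

namespace Literature.NumberTheory.Rogawski1990

open Literature.NumberTheory.QuadraticForms Literature.NumberTheory.Automorphic Literature.NumberTheory.Automorphic.UnitaryGroup

/-! ## §1 Tame evaluations of the local Hilbert symbol at a finite place -/

section Tame

variable (K : Type) [Field K] [NumberField K] (v : HeightOneSpectrum (𝓞 K))

omit [NumberField K] in
/-- `(1, d) = 1` (`1·1² + d·0² = 1`). [cite: Omeara1963, §63B] -/
theorem hilbertSymbol_one_left' {F : Type*} [Field F] (d : F) : hilbertSymbol F 1 d = 1 :=
  (hilbertSymbol_eq_one_iff _ _).2 ⟨1, 0, by ring⟩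

/-- **A unit with SQUARE residue has trivial symbols** at a non-dyadic place: `β = s²` by Hensel (★ `isSquare_of_isSquare_residue`), so `(β, d)_v = (1, d)_v = 1` for every `d`.
[cite: Omeara1963, §63B Example 63:12] -/
theorem hilbertSymbol_coe_eq_one_of_isSquare_residue (h2 : IsUnit (2 : 𝒪[v.adicCompletion K])) {β : 𝒪[v.adicCompletion K]} (hβ : IsUnit β)
    (hsq : IsSquare (IsLocalRing.residue 𝒪[v.adicCompletion K] β)) (d : v.adicCompletion K) :
    hilbertSymbol (v.adicCompletion K) (β : v.adicCompletion K) d = 1 := by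
  obtain ⟨s, hs⟩ := isSquare_of_isSquare_residue K v h2 hβ hsq
  have hs0 : (s : v.adicCompletion K) ≠ 0 := by
    intro h0
    have hβ0 : (β : v.adicCompletion K) = 0 := by rw [hs, Subring.coe_mul, h0, mul_zero]
    exact (hβ.map (algebraMap 𝒪[v.adicCompletion K] (v.adicCompletion K))).ne_zero hβ0
  rw [hs, Subring.coe_mul, ← one_mul ((s : v.adicCompletion K) * s), ← sq, hilbertSymbol_mul_sq_left _ _ hs0, hilbertSymbol_one_left']

/-- **`(β, d)_v = 1 ⟺ β̄ ∈ 𝓀_v²`** for a unit `β` and `d` of ODD valuation at a non-dyadic place (★ `hilbertSymbol_eq_neg_one_of_not_isSquare_residue_of_odd` for `⇒`).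
[cite: Omeara1963, §63B 63:11a and Example 63:12] [cite: Serre1979, Ch. XIV §3] -/
theorem hilbertSymbol_coe_eq_one_iff_isSquare_residue_of_odd (h2 : IsUnit (2 : 𝒪[v.adicCompletion K])) {β : 𝒪[v.adicCompletion K]} (hβ : IsUnit β)
    {d : v.adicCompletion K} (hd : Odd (WithZero.log (Valued.v d))) :
    hilbertSymbol (v.adicCompletion K) (β : v.adicCompletion K) d = 1 ↔ IsSquare (IsLocalRing.residue 𝒪[v.adicCompletion K] β) := by
  refine ⟨fun h => ?_, fun hsq => hilbertSymbol_coe_eq_one_of_isSquare_residue K v h2 hβ hsq d⟩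
  by_contra hns
  have hneg := hilbertSymbol_eq_neg_one_of_not_isSquare_residue_of_odd K v hns hd
  rw [h] at hneg
  exact absurd hneg (by norm_num)

/-- … and `(β, d)_v = −1 ⟺ β̄ ∉ 𝓀_v²` (the symbol takes only the values `±1`). [cite: Omeara1963, §63B 63:11a] -/
theorem hilbertSymbol_coe_eq_neg_one_iff_not_isSquare_residue_of_odd (h2 : IsUnit (2 : 𝒪[v.adicCompletion K])) {β : 𝒪[v.adicCompletion K]} (hβ : IsUnit β)
    {d : v.adicCompletion K} (hd : Odd (WithZero.log (Valued.v d))) :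
    hilbertSymbol (v.adicCompletion K) (β : v.adicCompletion K) d = -1 ↔ ¬ IsSquare (IsLocalRing.residue 𝒪[v.adicCompletion K] β) := by
  rw [← hilbertSymbol_coe_eq_one_iff_isSquare_residue_of_odd K v h2 hβ hd]
  unfold hilbertSymbol
  split_ifs <;> norm_num

/-- **`s₀ := (−1, d)_v = 1 ⟺ −1 ∈ 𝓀_v²`** for `d` of odd valuation at a non-dyadic place (`⟺ q_v ≡ 1 (4)`). [cite: Omeara1963, §63B Example 63:12] [cite: Serre1979, Ch. XIV §3] -/
theorem hilbertSymbol_neg_one_eq_one_iff_of_odd (h2 : IsUnit (2 : 𝒪[v.adicCompletion K])) {d : v.adicCompletion K} (hd : Odd (WithZero.log (Valued.v d))) :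
    hilbertSymbol (v.adicCompletion K) (-1) d = 1 ↔ IsSquare (-1 : IsLocalRing.ResidueField 𝒪[v.adicCompletion K]) := by
  have h := hilbertSymbol_coe_eq_one_iff_isSquare_residue_of_odd K v h2 (β := -1) isUnit_one.neg hd
  rwa [Subring.coe_neg, Subring.coe_one, map_neg, map_one] at h

/-- **`(d^k·x, d)_v = (−1, d)_v^k · (x, d)_v`** (bimultiplicativity at `v`, ★ `hilbertSymbol_adicCompletion_mul_left`, and `(d, d) = (d, −1)`). With `d = π` a uniformizer and `x = β`
a unit this evaluates the symbol of every `b = π^k β ≠ 0`. [cite: Omeara1963, §63B (formulas after 63:10)] [cite: LabesseLanglands1979, §2 (2.1)] -/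
theorem hilbertSymbol_pow_mul_self_right {d x : v.adicCompletion K} (hd : d ≠ 0) (hx : x ≠ 0) (k : ℕ) :
    hilbertSymbol (v.adicCompletion K) (d ^ k * x) d = hilbertSymbol (v.adicCompletion K) (-1) d ^ k * hilbertSymbol (v.adicCompletion K) x d := by
  haveI : CharZero (v.adicCompletion K) := charZero_of_injective_algebraMap (algebraMap K _).injective
  haveI : NeZero (2 : v.adicCompletion K) := ⟨two_ne_zero⟩
  induction k with
  | zero => rw [pow_zero, one_mul, pow_zero, one_mul]
  | succ k ih =>
    rw [pow_succ, mul_assoc, mul_comm d x, ← mul_assoc, hilbertSymbol_adicCompletion_mul_left K v (mul_ne_zero (pow_ne_zero _ hd) hx) hd hd, ih,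
      hilbertSymbol_self_right hd, hilbertSymbol_comm d (-1), pow_succ]
    ring

/-- **UNIT PART**: if `|b|_v = |π|_v^k` with `π ≠ 0` then `b = π^k·β` for a unit `β ∈ 𝒪_vˣ`. [cite: Serre1979, Ch. XIV §3] -/
theorem exists_eq_pow_mul_coe_unit {π b : v.adicCompletion K} (hπ : π ≠ 0) (k : ℕ) (hb : Valued.v b = Valued.v π ^ k) :
    ∃ β : 𝒪[v.adicCompletion K], IsUnit β ∧ b = π ^ k * (β : v.adicCompletion K) := by
  have hπk : π ^ k ≠ 0 := pow_ne_zero _ hπ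
  have hval : Valued.v (b / π ^ k) = 1 := by
    rw [map_div₀, hb, map_pow, div_self (pow_ne_zero _ ((Valuation.ne_zero_iff _).2 hπ))]
  refine ⟨⟨b / π ^ k, (Valuation.mem_integer_iff _ _).2 hval.le⟩, (isUnit_integer_iff K v _).2 hval, ?_⟩
  change b = π ^ k * (b / π ^ k)
  rw [mul_div_cancel₀ _ hπk]

end Tame

/-! ## §2 The CM generator at a ramified place: `θ_v = π·g²` with `π` a uniformizer of `L⁺_v`, so `(x, θ_v)_v = (x, π)_v` -/

section CM

variable (L : Type) [Field L] [NumberField L] [IsCMField L] {v : HeightOneSpectrum (𝓞 ↥(maximalRealSubfield L))}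
  (w : PlacesOver L v) (hw : IsCMField.complexConj L • w.1 = w.1)

include hw in
/-- **`θ_v = π·g²` AT A RAMIFIED PLACE.**  `he : e(w|v) ≠ 1`, tame `|2|_w = 1`; `ϖ_E` a skew uniformizer of `L_w` (★ p843426) and `α_w` the CM generator's square root (skew, ★ R-4
`exists_skew_ne_zero`'s element): `ϖ_E²` and `α_w∕ϖ_E` are `σ_w`-fixed, hence `= ι_w π`, `ι_w g` with `π, g ∈ L⁺_v` (★ `exists_toPlace_eq_of_galAdicCompletionMap_eq`); `|ι_w π|_w = exp(−2)` and
`e = 2` (★ `ramificationIdx'_eq_two_of_ne_one`, ★ `valued_toPlace`) give `|π|_v = exp(−1)`; and `ι_w θ_v = α_w² = ι_w(π g²)`. [cite: Serre1979, Ch. XIV §3] [cite: Rogawski1990, §4.9 p. 55] -/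
theorem exists_uniformizer_cmQuadraticGenerator_eq_mul_sq (he : v.asIdeal.ramificationIdx' w.1.asIdeal ≠ 1) (h2 : Valued.v (2 : w.1.adicCompletion L) = 1) :
    ∃ (π g : v.adicCompletion ↥(maximalRealSubfield L)) (ϖE : (w.1.adicCompletion L)ˣ),
      Valued.v π = WithZero.exp (-1 : ℤ) ∧ g ≠ 0 ∧ galAdicCompletionMap (L := L) (IsCMField.complexConj L) hw ϖE = -ϖE ∧
      toPlace v w π = (ϖE : w.1.adicCompletion L) ^ 2 ∧
      algebraMap ↥(maximalRealSubfield L) (v.adicCompletion ↥(maximalRealSubfield L)) ((cmQuadraticGenerator L : 𝓞 ↥(maximalRealSubfield L)) : ↥(maximalRealSubfield L)) = π * g ^ 2 := by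
  haveI : Algebra.IsQuadraticExtension ↥(maximalRealSubfield L) L := IsCMField.isQuadraticExtension L
  have hc1 : IsCMField.complexConj L ≠ 1 := IsCMField.complexConj_ne_one L
  set σ := galAdicCompletionMap (L := L) (IsCMField.complexConj L) hw with hσdef
  -- the skew uniformizer and the CM generator
  obtain ⟨ϖE, hϖEv, hσϖE⟩ := exists_uniformizer_galAdicCompletionMap_complexConj_eq_neg_of_ramified L w hw he h2
  obtain ⟨α, hα0, hcα, hsq⟩ := cmQuadraticGenerator_spec L
  have hσα : σ (algebraMap L (w.1.adicCompletion L) α) = -algebraMap L (w.1.adicCompletion L) α := by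
    rw [galAdicCompletionMap_complexConj_algebraMap L v w hw α, cmConjRingHom_apply, hcα, map_neg]
  have hαw0 : algebraMap L (w.1.adicCompletion L) α ≠ 0 := fun h0 => hα0 ((algebraMap L (w.1.adicCompletion L)).injective (by rw [h0, map_zero]))
  have hϖE0 : (ϖE : w.1.adicCompletion L) ≠ 0 := ϖE.ne_zero
  -- `ϖ_E²` and `α_w / ϖ_E` are `σ_w`-fixed
  have hfix2 : σ ((ϖE : w.1.adicCompletion L) ^ 2) = (ϖE : w.1.adicCompletion L) ^ 2 := by rw [map_pow, hσϖE, neg_sq]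
  have hfixg : σ (algebraMap L (w.1.adicCompletion L) α / ϖE) = algebraMap L (w.1.adicCompletion L) α / ϖE := by rw [map_div₀, hσα, hσϖE, neg_div_neg_eq]
  obtain ⟨π, hπ⟩ := exists_toPlace_eq_of_galAdicCompletionMap_eq (IsCMField.complexConj L) w hc1 hw _ hfix2
  obtain ⟨g, hg⟩ := exists_toPlace_eq_of_galAdicCompletionMap_eq (IsCMField.complexConj L) w hc1 hw _ hfixg
  -- valuation of `π`: `|ι_w π|_w = |π|_v ^ 2 = exp(−2)`
  have he2 := Liu2021.LemD1IndexedNonVacuityRamifiedPlace.ramificationIdx'_eq_two_of_ne_one L v (IsCMField.complexConj L) hc1 w hw he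
  have hvπ2 : Valued.v π ^ 2 = WithZero.exp (-2 : ℤ) := by
    rw [← he2, ← valued_toPlace v w π, hπ, map_pow, hϖEv, ← WithZero.exp_nsmul]
    norm_num
  have hvπ0 : Valued.v π ≠ 0 := fun h0 => by
    rw [h0, zero_pow two_ne_zero] at hvπ2
    exact WithZero.zero_ne_coe hvπ2
  have hvπ : Valued.v π = WithZero.exp (-1 : ℤ) := by
    have hlog := congrArg WithZero.log hvπ2
    rw [WithZero.log_pow, WithZero.log_exp] at hlog
    have h1 : WithZero.log (Valued.v π) = -1 := by
      have : (2 : ℕ) • WithZero.log (Valued.v π) = 2 * WithZero.log (Valued.v π) := by simp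
      omega
    rw [← WithZero.exp_log hvπ0, h1]
  -- `g ≠ 0` and `θ_v = π g²`
  have hg0 : g ≠ 0 := by
    intro h0
    rw [h0, map_zero] at hg
    exact div_ne_zero hαw0 hϖE0 hg.symm
  refine ⟨π, g, ϖE, hvπ, hg0, hσϖE, hπ, (toPlace v w).injective ?_⟩
  have hθw : toPlace v w (algebraMap ↥(maximalRealSubfield L) (v.adicCompletion ↥(maximalRealSubfield L))
      ((cmQuadraticGenerator L : 𝓞 ↥(maximalRealSubfield L)) : ↥(maximalRealSubfield L))) = algebraMap L (w.1.adicCompletion L) (α ^ 2) := by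
    rw [hsq]
    exact toPlace_coe v w ((cmQuadraticGenerator L : 𝓞 ↥(maximalRealSubfield L)) : ↥(maximalRealSubfield L))
  rw [map_mul, map_pow, hπ, hg, hθw, map_pow]
  field_simp

include hw in
/-- **`(x, θ_v)_v = (x, π)_v` AT A RAMIFIED PLACE** for the uniformizer `π` of `exists_uniformizer_cmQuadraticGenerator_eq_mul_sq` (the symbol only sees square classes, ★
`hilbertSymbol_mul_sq_right`): ★ R-4's sign `(b₀, θ)_v` is `(b₀, π)_v`, evaluated by §1 as `(−1, π)_v^k · (β₀, π)_v` for `b₀ = π^k β₀`. [cite: Serre1979, Ch. XIV §3]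
[cite: LabesseLanglands1979, §2 (2.1)–(2.2)] [cite: Rogawski1990, §4.9 p. 55] -/
theorem hilbertSymbol_cmQuadraticGenerator_eq_of_ramified (he : v.asIdeal.ramificationIdx' w.1.asIdeal ≠ 1) (h2 : Valued.v (2 : w.1.adicCompletion L) = 1) :
    ∃ (π : v.adicCompletion ↥(maximalRealSubfield L)) (ϖE : (w.1.adicCompletion L)ˣ),
      Valued.v π = WithZero.exp (-1 : ℤ) ∧ galAdicCompletionMap (L := L) (IsCMField.complexConj L) hw ϖE = -ϖE ∧ toPlace v w π = (ϖE : w.1.adicCompletion L) ^ 2 ∧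
      ∀ x : v.adicCompletion ↥(maximalRealSubfield L),
        hilbertSymbol (v.adicCompletion ↥(maximalRealSubfield L)) x
            (algebraMap ↥(maximalRealSubfield L) _ ((cmQuadraticGenerator L : 𝓞 ↥(maximalRealSubfield L)) : ↥(maximalRealSubfield L))) =
          hilbertSymbol (v.adicCompletion ↥(maximalRealSubfield L)) x π := by
  obtain ⟨π, g, ϖE, hvπ, hg0, hσϖE, hπ, hθ⟩ := exists_uniformizer_cmQuadraticGenerator_eq_mul_sq L w hw he h2
  exact ⟨π, ϖE, hvπ, hσϖE, hπ, fun x => by rw [hθ, hilbertSymbol_mul_sq_right _ _ hg0]⟩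

omit [IsCMField L] in
/-- **`log|π|_v = −1` is odd** (bookkeeping for §1 at the uniformizer of §2). [cite: Serre1979, Ch. XIV §3] -/
theorem odd_log_valued_of_eq_exp_neg_one {π : v.adicCompletion ↥(maximalRealSubfield L)} (hπ : Valued.v π = WithZero.exp (-1 : ℤ)) :
    Odd (WithZero.log (Valued.v π)) := by
  rw [hπ, WithZero.log_exp]; exact ⟨-1, by norm_num⟩

end CM

end Literature.NumberTheory.Rogawski1990

end
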